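import Summits.MatrixMultiplication.OmegaCensus.DicyclicNoSubFourP5
import HarnessLib

/-!
# `β(C₂ × Q₄₀) ∈ {96, 98}`: the case `m = 10` below the counting threshold

ω-census, family (b3).  Framing: lottery ticket; floor = certified bounds/negative ranges.

`C₂ × Q₄₀ = G(ℤ₂ × ℤ₂₀, (0,10))`, `|A| = 40 ≡ 1 (mod 3)`, mod-one law `104`, not attained (H′); the general results of
`DihedralLikeLawGap12.lean` need `|A| ≥ 52`.  Here the vertex-counting arithmetic is done at `N = 40` directly
(`vertex_fc40`, 30 372 evaluations by `decide`): a volume in `[97, 103]` forces `V = 98` (parts `(1,1 | 3,4 | 3,4)` up to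
roles — total slack `26`, the sporadic pattern) or `V = 100` with a P1 shape (two dominoes) or the P5 shape `(2,3 | 1,1 | 5,5)`.
P1 is excluded by saturation (`quot_cyclic_of_two_two_sub_four`, `A/⟨c₀⟩ = ℤ₂ × ℤ₁₀` not cyclic) and P5 by
`no_sub_four_P5_of_c0_ne_zero`.  Hence (`c2_quaternion_40`): **every TPP triple of `C₂ × Q₄₀` has `|S||T||U| ≤ 96` or
`|S||T||U| = 98`**, and `96 = 16⌊20/3⌋` is attained; the census window `[96, 102]` shrinks to `{96, 98}` (`98` only through
parts `(1,1 | 3,4 | 3,4)`; kissat does not decide that shape in 3 000 s, seat data).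
-/

namespace Summit.MatrixMultiplication.OmegaCensus

open Literature.Combinatorics.Additive Finset

/-- Finite check at `N = 40`: for `S = S'+1`, `T = T'+1 ≤ 103/S`, `97 ≤ STU ≤ 103` and all splits, the eight vertex
constraints force `STU = 98`, or `STU = 100` with a P1 or P5 shape (30 372 evaluations). [folklore] -/
theorem vertex_fc40 :
    ((List.range 103).all fun S' =>
      (List.range (103 / (S' + 1))).all fun T' =>
      (List.range (103 / ((S' + 1) * (T' + 1)) - 96 / ((S' + 1) * (T' + 1)))).all fun U'' =>
      (List.range (S' + 2)).all fun s₀ => (List.range (T' + 2)).all fun t₀ =>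
      (List.range (U'' + 96 / ((S' + 1) * (T' + 1)) + 2)).all fun u₀ =>
        decide (
          let s₁ := S' + 1 - s₀
          let t₁ := T' + 1 - t₀
          let u₁ := U'' + 96 / ((S' + 1) * (T' + 1)) + 1 - u₀
          s₁ * t₀ * u₀ + s₀ * t₁ * u₀ + s₀ * t₀ * u₁ ≤ 40 → s₀ * t₁ * u₁ + s₁ * t₀ * u₁ + s₁ * t₁ * u₀ ≤ 40 →
          s₀ * t₀ * u₀ + s₁ * t₁ * u₀ + s₁ * t₀ * u₁ ≤ 40 → s₁ * t₁ * u₁ + s₀ * t₀ * u₁ + s₀ * t₁ * u₀ ≤ 40 →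
          s₁ * t₁ * u₀ + s₀ * t₀ * u₀ + s₀ * t₁ * u₁ ≤ 40 → s₀ * t₀ * u₁ + s₁ * t₁ * u₁ + s₁ * t₀ * u₀ ≤ 40 →
          s₁ * t₀ * u₁ + s₀ * t₁ * u₁ + s₀ * t₀ * u₀ ≤ 40 → s₀ * t₁ * u₀ + s₁ * t₀ * u₀ + s₁ * t₁ * u₁ ≤ 40 →
          (s₀ + s₁) * (t₀ + t₁) * (u₀ + u₁) = 98 ∨
          ((s₀ + s₁) * (t₀ + t₁) * (u₀ + u₁) = 100 ∧
            ((t₀ = t₁ ∧ u₀ = u₁ ∧ (t₀ * u₀ = 1 ∨ (t₀ * u₀ = 5 ∧ (s₀ = s₁ + 1 ∨ s₁ = s₀ + 1)))) ∨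
             (s₀ = s₁ ∧ u₀ = u₁ ∧ (s₀ * u₀ = 1 ∨ (s₀ * u₀ = 5 ∧ (t₀ = t₁ + 1 ∨ t₁ = t₀ + 1)))) ∨
             (s₀ = s₁ ∧ t₀ = t₁ ∧ (s₀ * t₀ = 1 ∨ (s₀ * t₀ = 5 ∧ (u₀ = u₁ + 1 ∨ u₁ = u₀ + 1)))))))) = true := by
  decide

/-- The arithmetic at `N = 40`: a volume in `[97, 103]` is `98`, or `100` with a P1/P5 shape. [folklore] -/
theorem shape40_of_vertex_bounds (s₀ s₁ t₀ t₁ u₀ u₁ : ℕ)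
    (h000 : s₁ * t₀ * u₀ + s₀ * t₁ * u₀ + s₀ * t₀ * u₁ ≤ 40) (h111 : s₀ * t₁ * u₁ + s₁ * t₀ * u₁ + s₁ * t₁ * u₀ ≤ 40)
    (h100 : s₀ * t₀ * u₀ + s₁ * t₁ * u₀ + s₁ * t₀ * u₁ ≤ 40) (h011 : s₁ * t₁ * u₁ + s₀ * t₀ * u₁ + s₀ * t₁ * u₀ ≤ 40)
    (h010 : s₁ * t₁ * u₀ + s₀ * t₀ * u₀ + s₀ * t₁ * u₁ ≤ 40) (h101 : s₀ * t₀ * u₁ + s₁ * t₁ * u₁ + s₁ * t₀ * u₀ ≤ 40)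
    (h001 : s₁ * t₀ * u₁ + s₀ * t₁ * u₁ + s₀ * t₀ * u₀ ≤ 40) (h110 : s₀ * t₁ * u₀ + s₁ * t₀ * u₀ + s₁ * t₁ * u₁ ≤ 40)
    (hlo : 97 ≤ (s₀ + s₁) * (t₀ + t₁) * (u₀ + u₁)) (hhi : (s₀ + s₁) * (t₀ + t₁) * (u₀ + u₁) ≤ 103) :
    (s₀ + s₁) * (t₀ + t₁) * (u₀ + u₁) = 98 ∨
    ((s₀ + s₁) * (t₀ + t₁) * (u₀ + u₁) = 100 ∧
      ((t₀ = t₁ ∧ u₀ = u₁ ∧ (t₀ * u₀ = 1 ∨ (t₀ * u₀ = 5 ∧ (s₀ = s₁ + 1 ∨ s₁ = s₀ + 1)))) ∨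
       (s₀ = s₁ ∧ u₀ = u₁ ∧ (s₀ * u₀ = 1 ∨ (s₀ * u₀ = 5 ∧ (t₀ = t₁ + 1 ∨ t₁ = t₀ + 1)))) ∨
       (s₀ = s₁ ∧ t₀ = t₁ ∧ (s₀ * t₀ = 1 ∨ (s₀ * t₀ = 5 ∧ (u₀ = u₁ + 1 ∨ u₁ = u₀ + 1)))))) := by
  set S := s₀ + s₁ with hS
  set T := t₀ + t₁ with hT
  set U := u₀ + u₁ with hU
  have hS1 : 1 ≤ S := Nat.pos_of_ne_zero (by rintro h0; rw [h0, zero_mul, zero_mul] at hlo; omega)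
  have hT1 : 1 ≤ T := Nat.pos_of_ne_zero (by rintro h0; rw [h0, mul_zero, zero_mul] at hlo; omega)
  have hU1 : 1 ≤ U := Nat.pos_of_ne_zero (by rintro h0; rw [h0, mul_zero] at hlo; omega)
  have hST : S * T ≤ 103 := le_trans (Nat.le_mul_of_pos_right _ hU1) hhi
  have hSle : S ≤ 103 := le_trans (Nat.le_mul_of_pos_right _ hT1) hST
  -- loop indices
  have iS : S - 1 < 103 := by omega
  have iT : T - 1 < 103 / (S - 1 + 1) := by
    rw [Nat.sub_add_cancel hS1]
    have : T ≤ 103 / S := (Nat.le_div_iff_mul_le hS1).2 (by rw [mul_comm]; exact hST)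
    omega
  have hq2 : U ≤ 103 / (S * T) := (Nat.le_div_iff_mul_le (by positivity)).2 (by rw [mul_comm]; exact hhi)
  have hq1 : 96 / (S * T) < U := (Nat.div_lt_iff_lt_mul (by positivity)).2 (by rw [mul_comm]; omega)
  have iU : U - (96 / ((S - 1 + 1) * (T - 1 + 1)) + 1) <
      103 / ((S - 1 + 1) * (T - 1 + 1)) - 96 / ((S - 1 + 1) * (T - 1 + 1)) := by
    rw [Nat.sub_add_cancel hS1, Nat.sub_add_cancel hT1]; omega
  have is₀ : s₀ < S - 1 + 2 := by omega
  have it₀ : t₀ < T - 1 + 2 := by omega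
  have iu₀ : u₀ < U - (96 / ((S - 1 + 1) * (T - 1 + 1)) + 1) + 96 / ((S - 1 + 1) * (T - 1 + 1)) + 2 := by
    rw [Nat.sub_add_cancel hS1, Nat.sub_add_cancel hT1]; omega
  have key := vertex_fc40
  simp only [List.all_eq_true, List.mem_range, decide_eq_true_iff] at key
  have k := key (S - 1) iS (T - 1) iT (U - (96 / ((S - 1 + 1) * (T - 1 + 1)) + 1)) iU s₀ is₀ t₀ it₀ u₀ iu₀
  -- identify the `let`-bound complements with `s₁, t₁, u₁`
  have e1 : S - 1 + 1 - s₀ = s₁ := by omega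
  have e2 : T - 1 + 1 - t₀ = t₁ := by omega
  have e3 : U - (96 / ((S - 1 + 1) * (T - 1 + 1)) + 1) + 96 / ((S - 1 + 1) * (T - 1 + 1)) + 1 - u₀ = u₁ := by
    rw [Nat.sub_add_cancel hS1, Nat.sub_add_cancel hT1]; omega
  simp only [e1, e2, e3] at k
  exact k h000 h111 h100 h011 h010 h101 h001 h110

section C2Q40

/-- **`β(C₂ × Q₄₀) ∈ {96, 98}`**: every TPP triple of `C₂ × Q₄₀ = Multiplicative (ZMod 2) × QuaternionGroup 10` has
`|S||T||U| ≤ 96` or `|S||T||U| = 98`, and `96` is attained. [folklore] -/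
theorem c2_quaternion_40 :
    (∀ S T U : Finset (Multiplicative (ZMod 2) × QuaternionGroup 10), TripleProductProperty S T U →
        S.card * T.card * U.card ≤ 96 ∨ S.card * T.card * U.card = 98) ∧
    ∃ S T U : Finset (Multiplicative (ZMod 2) × QuaternionGroup 10), TripleProductProperty S T U ∧
      S.card * T.card * U.card = 96 := by
  refine ⟨fun S T U h => ?_, c2_quaternion_volume_ge (m := 10) (by norm_num)⟩
  have hlaw := c2_quaternion_tpp_volume_le_law (m := 10) h
  have hne := no_mod_one_law_c2_quaternion (m := 10) ⟨5, rfl⟩ (by norm_num) h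
  by_cases hlo : 97 ≤ S.card * T.card * U.card
  swap; · left; omega
  right
  obtain ⟨hc₀, hnq⟩ := z2_z2m_quot_half_noncyclic (m := 10) ⟨5, rfl⟩
  refine c2_quaternion_presentation (m := 10) fun ρ τ c₀ hρρ hρτ hτρ hττ hρ hτ hne' hsurj hc => ?_
  subst hc
  have hcard : Fintype.card (ZMod 2 × ZMod (2 * 10)) = 40 := by rw [Fintype.card_prod, ZMod.card, ZMod.card]
  obtain ⟨h000, h111, h100, h011, h010, h101, h001, h110⟩ := vertex_counting' hρρ hρτ hτρ hττ hρ hτ hne' h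
  rw [hcard] at h000 h111 h100 h011 h010 h101 h001 h110
  have cS := card_eq_parts' hρ hτ hne' hsurj S
  have cT := card_eq_parts' hρ hτ hne' hsurj T
  have cU := card_eq_parts' hρ hτ hne' hsurj U
  set s₀ := (univ.filter fun a : ZMod 2 × ZMod (2 * 10) => ρ a ∈ S).card with hs₀
  set s₁ := (univ.filter fun a : ZMod 2 × ZMod (2 * 10) => τ a ∈ S).card with hs₁
  set t₀ := (univ.filter fun a : ZMod 2 × ZMod (2 * 10) => ρ a ∈ T).card with ht₀
  set t₁ := (univ.filter fun a : ZMod 2 × ZMod (2 * 10) => τ a ∈ T).card with ht₁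
  set u₀ := (univ.filter fun a : ZMod 2 × ZMod (2 * 10) => ρ a ∈ U).card with hu₀
  set u₁ := (univ.filter fun a : ZMod 2 × ZMod (2 * 10) => τ a ∈ U).card with hu₁
  rw [cS, cT, cU] at hlaw hne hlo
  norm_num at hlaw
  have hshape := shape40_of_vertex_bounds s₀ s₁ t₀ t₁ u₀ u₁ h000 h111 h100 h011 h010 h101 h001 h110 hlo (by omega)
  rcases hshape with h98 | ⟨h100, hsh⟩
  · rw [cS, cT, cU]; exact h98
  · exfalso
    have hV : 3 * (S.card * T.card * U.card) + 20 = 8 * Fintype.card (ZMod 2 × ZMod (2 * 10)) := by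
      rw [hcard, cS, cT, cU, h100]
    have hV_TUS : 3 * (T.card * U.card * S.card) + 20 = 8 * Fintype.card (ZMod 2 × ZMod (2 * 10)) := by
      rw [show T.card * U.card * S.card = S.card * T.card * U.card by ring]; exact hV
    have hV_UST : 3 * (U.card * S.card * T.card) + 20 = 8 * Fintype.card (ZMod 2 × ZMod (2 * 10)) := by
      rw [show U.card * S.card * T.card = S.card * T.card * U.card by ring]; exact hV
    have hV_SUT : 3 * (S.card * U.card * T.card) + 20 = 8 * Fintype.card (ZMod 2 × ZMod (2 * 10)) := by
      rw [show S.card * U.card * T.card = S.card * T.card * U.card by ring]; exact hV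
    have hV_TSU : 3 * (T.card * S.card * U.card) + 20 = 8 * Fintype.card (ZMod 2 × ZMod (2 * 10)) := by
      rw [show T.card * S.card * U.card = S.card * T.card * U.card by ring]; exact hV
    have hV_UTS : 3 * (U.card * T.card * S.card) + 20 = 8 * Fintype.card (ZMod 2 × ZMod (2 * 10)) := by
      rw [show U.card * T.card * S.card = S.card * T.card * U.card by ring]; exact hV
    have hmod : Fintype.card (ZMod 2 × ZMod (2 * 10)) % 3 = 1 := by rw [hcard]
    have hA : 14 ≤ Fintype.card (ZMod 2 × ZMod (2 * 10)) := by rw [hcard]; norm_num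
    have five : ∀ {d e : ℕ}, d * e = 5 → (d = 1 ∧ e = 5) ∨ (d = 5 ∧ e = 1) := by
      intro d e hde
      have hd : d ∣ 5 := ⟨e, hde.symm⟩
      have hd5 : d ≤ 5 := Nat.le_of_dvd (by norm_num) hd
      interval_cases d <;> omega
    rcases hsh with ⟨et, eu, hp⟩ | ⟨es, eu, hp⟩ | ⟨es, et, hp⟩
    · rcases hp with hp | ⟨hp, hδ⟩
      · -- P1: `T`, `U` dominoes
        have ht := Nat.eq_one_of_mul_eq_one_right hp
        have hu := Nat.eq_one_of_mul_eq_one_left hp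
        exact hnq (quot_cyclic_of_two_two_sub_four hρρ hρτ hτρ hττ hc₀ hρ hτ hne' hsurj hmod hA h.rotate
          ht (by omega) hu (by omega) hV_TUS)
      · rcases five hp with ⟨hd, he⟩ | ⟨hd, he⟩
        · exact no_sub_four_P5_of_c0_ne_zero hρρ hρτ hτρ hττ hc₀ hρ hτ hne' hsurj h hδ hd (by omega) he (by omega) hV
        · exact no_sub_four_P5_of_c0_ne_zero hρρ hρτ hτρ hττ hc₀ hρ hτ hne' hsurj (tpp_reverse h.rotate) hδ he
            (by omega) hd (by omega) hV_SUT
    · rcases hp with hp | ⟨hp, hδ⟩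
      · have hs := Nat.eq_one_of_mul_eq_one_right hp
        have hu := Nat.eq_one_of_mul_eq_one_left hp
        exact hnq (quot_cyclic_of_two_two_sub_four hρρ hρτ hτρ hττ hc₀ hρ hτ hne' hsurj hmod hA h.rotate.rotate
          hu (by omega) hs (by omega) hV_UST)
      · rcases five hp with ⟨hd, he⟩ | ⟨hd, he⟩
        · exact no_sub_four_P5_of_c0_ne_zero hρρ hρτ hτρ hττ hc₀ hρ hτ hne' hsurj (tpp_reverse h.rotate.rotate) hδ hd
            (by omega) he (by omega) hV_TSU
        · exact no_sub_four_P5_of_c0_ne_zero hρρ hρτ hτρ hττ hc₀ hρ hτ hne' hsurj h.rotate hδ he (by omega) hd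
            (by omega) hV_TUS
    · rcases hp with hp | ⟨hp, hδ⟩
      · have hs := Nat.eq_one_of_mul_eq_one_right hp
        have ht := Nat.eq_one_of_mul_eq_one_left hp
        exact hnq (quot_cyclic_of_two_two_sub_four hρρ hρτ hτρ hττ hc₀ hρ hτ hne' hsurj hmod hA h
          hs (by omega) ht (by omega) hV)
      · rcases five hp with ⟨hd, he⟩ | ⟨hd, he⟩
        · exact no_sub_four_P5_of_c0_ne_zero hρρ hρτ hτρ hττ hc₀ hρ hτ hne' hsurj h.rotate.rotate hδ hd (by omega) he
            (by omega) hV_UST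
        · exact no_sub_four_P5_of_c0_ne_zero hρρ hρτ hτρ hττ hc₀ hρ hτ hne' hsurj (tpp_reverse h) hδ he (by omega) hd
            (by omega) hV_UTS

end C2Q40

end Summit.MatrixMultiplication.OmegaCensus
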